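import Summits.BirchSwinnertonDyer.BirchSwinnertonDyer.Theorems.GenusKolyvaginAtTwoEquivariantChebotarevAtTwoIngredients

/-!
# Route `GenusKolyvaginAtTwo`, LINE 6, Q5 `EquivariantChebotarevAtTwo`: McCallum's Galois element
# `ρ` at `p = 2` for a `τ`-STABLE family (drop-in for `IsLiftOfAut.exists_h1Eval_conj_mul_order`)
# (helper, PROVED; seat `bsd-line-gk2-p2` g5, cell `bsd-f1-sign2`)

Sequel to `Theorems/GenusKolyvaginAtTwoEquivariantChebotarevAtTwoIngredients.lean` (same seat).
The tree's odd-`p` Čebotarev proof of McCallum 1991 Cor. 3.2 at level `p^M`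
(`exists_kolyvaginPrime_gt_pow`, `HeegnerPointsKolyvaginPrimaryCebotarevProofs`) obtains in its
Step B an element `ρ ∈ Γ_{K(E[p^M])}` with `ord [c_i, ρ^τ ρ m^τ m] = p^{N_i}` for all `m` in the
subgroup `𝒩` where the `[c_i, ·]` vanish (`IsLiftOfAut.exists_h1Eval_conj_mul_order`), using
`±`-eigenclasses, `±`-eigenvectors and `2 ∈ (ℤ/p^M)^×`. This file proves the SAME conclusion at
`p = 2` for a `τ`-STABLE family `σ_* c_i = c_{π i}` (Q5's hypothesis), from:
`E[2]` a simple `Γ_K`-module with scalar commutant, restriction to `Γ_{K(E[n])}` injective on the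
span (Q5's binder), and a point `P ∈ E(K̄)[n]` with `2^M P = 0` and `ℤP + ℤτP` free over `ℤ/2^M`
(Q1 `CyclicTorsionOfNegDisc` transported to `E(K̄)`), exponents `N_i ≤ e_i ≤ M` constant on
`π`-orbits:

* `h1Eval_conjGalCMH_of_tauStable` — `[c_i, τ⁻¹ρτ] = τ·[c_{π i}, ρ]` (from the tree's
  `IsLiftOfAut.h1Eval_conjAct`, the involution `τ`);
* `exists_h1Eval_conj_mul_order_tauStable` — the Galois element: targets
  `x = (x_i)` from `exists_orders_of_tauStable`, realised as `([c_i, ρ])_i` by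
  `exists_h1Eval_eq_of_indep_of_res`; then for `m ∈ 𝒩`,
  `[c_i, (ρm)^τ (ρm)] = τ·x_{π i} + x_i` has order exactly `2^{N_i}`.

With this, Steps C–H of `exists_kolyvaginPrime_gt_pow` (the finite exceptional set, Čebotarev in
`c₀ · res(ρ𝒩)`, inertness, the local criterion at `λ`) are `p`-generic. What Q5 then still needs
at `2`: `E[2]` simple with scalar commutant as a `Γ_K`-module — true when `ρ̄_{E,2}(Γ_K) = GL₂(𝔽₂)`,
i.e. `K ≠ ℚ(√Δ_E)`, a binder Q5 does not carry (on `K = ℚ(√Δ_E)` the image is `A₃` and the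
commutant is `𝔽₄`); and the named fact `Automorphic.chebotarev_artinRep`. BSD is not proved by this.

References: [McCallumLMS1991] §3 (2), Prop. 3.1, Cor. 3.2 (pp. 279–280); [GrossLMS1991] §9.
-/

set_option autoImplicit false
set_option linter.dupNamespace false

noncomputable section

open scoped Classical

namespace Summit.BirchSwinnertonDyer.BirchSwinnertonDyer.Theorems.GenusExact

open WeierstrassCurve Field Finset
open Literature.NumberTheory.EllipticCurves

universe u v

variable {k : Type v} {K : Type u} [Field k] [Field K] [Algebra k K] (W : WeierstrassCurve k)
variable {σ : K ≃ₐ[k] K} {τ : AlgebraicClosure K ≃+* AlgebraicClosure K}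

/-- **`[c_i, τ⁻¹ρτ] = τ·[c_{π i}, ρ]` for a `τ`-stable family** (`σ_* c_i = c_{π i}`, `τ` an
involutive lift of `σ`, `ρ ∈ Γ_{K(E[n])}`): the tree's `[σ_* x, ρ] = τ[x, τ⁻¹ρτ]`
(`IsLiftOfAut.h1Eval_conjAct`) read on the family. [cite: McCallumLMS1991, Prop. 3.1 (proof)]
[cite: GrossLMS1991, §9] -/
theorem h1Eval_conjGalCMH_of_tauStable (hτ : IsLiftOfAut σ τ)
    (hinv : ∀ x, τ (τ x) = x) (n : ℤ) {ι : Type*}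
    {xs : ι → galH1Torsion (W.baseChange K) n} {π : ι → ι}
    (hxs : ∀ i, conjAct W σ n (xs i) = xs (π i)) {ρ : absoluteGaloisGroup K}
    (hρ : ρ ∈ torsionFixing (W.baseChange K) n) (i : ι) :
    h1Eval (W.baseChange K) n (xs i) (hτ.conjGalCMH ρ) =
      hτ.torsionMap W n (h1Eval (W.baseChange K) n (xs (π i)) ρ) := by
  have h := hτ.h1Eval_conjAct W n (xs i) hρ
  rw [hxs i] at h
  rw [h, hτ.torsionMap_torsionMap W hinv]

/-- **McCallum's Galois element at `p = 2` for a `τ`-stable family** (drop-in for the tree's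
`IsLiftOfAut.exists_h1Eval_conj_mul_order`). `K/k` with `σ ∈ Aut(K/k)` and an involutive lift `τ`
to `K̄`; `2 ∣ n`; `E[2]` a simple `Γ_K`-module with scalar commutant; `P ∈ E(K̄)[n]` with `2^M P = 0`
and `a P + b τP = 0 ⟹ 2^M ∣ a, b`; classes `x_i ∈ H¹(K, E[n])` with `σ_* x_i = x_{π i}` (`π` an
involution), killed by `2^{e_i}`, independent, with restriction to `Γ_{K(E[n])}` injective on their
span; exponents `N_i ≤ e_i ≤ M` with `N_{π i} = N_i`. Then some `ρ ∈ Γ_{K(E[n])}` has, for every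
`m ∈ 𝒩 = {[x_i, ·] = 0 ∀ i}` and every `i`: `2^{N_i} [x_i, (ρm)^τ(ρm)] = 0` and
`2^{N_i − 1} [x_i, (ρm)^τ(ρm)] ≠ 0` (`N_i ≠ 0`). [cite: McCallumLMS1991, §3 (2), Prop. 3.1, Cor. 3.2] -/
theorem exists_h1Eval_conj_mul_order_tauStable [W.IsElliptic] (hτ : IsLiftOfAut σ τ)
    (hinv : ∀ x, τ (τ x) = x) {n : ℤ} (h2n : (2 : ℤ) ∣ n) {M : ℕ}
    (hS : ∀ H : AddSubgroup (geomTorsion (W.baseChange K) 2),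
      (∀ g : absoluteGaloisGroup K, ∀ t ∈ H, g • t ∈ H) → H = ⊥ ∨ H = ⊤)
    (hC : ∀ f : geomTorsion (W.baseChange K) 2 →+ geomTorsion (W.baseChange K) 2,
      (∀ (g : absoluteGaloisGroup K) (t : geomTorsion (W.baseChange K) 2), f (g • t) = g • f t) →
        ∃ c : ℤ, ∀ t, f t = c • t)
    {P : geomTorsion (W.baseChange K) n} (hPM : (2 : ℤ) ^ M • P = 0)
    (hfree : ∀ a b : ℤ, a • P + b • hτ.torsionMap W n P = 0 → (2 : ℤ) ^ M ∣ a ∧ (2 : ℤ) ^ M ∣ b)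
    {ι : Type*} [Fintype ι] {xs : ι → galH1Torsion (W.baseChange K) n} {π : ι → ι}
    (hπ : ∀ i, π (π i) = i) (hxs : ∀ i, conjAct W σ n (xs i) = xs (π i))
    (e : ι → ℕ) (he : ∀ i, ((2 : ℤ) ^ e i) • xs i = 0)
    (hind : ∀ a : ι → ℤ, ∑ i, a i • xs i = 0 → ∀ i, ((2 : ℤ) ^ e i) ∣ a i)
    (hres : ∀ a : ι → ℤ, (∀ ρ ∈ torsionFixing (W.baseChange K) n,
      h1Eval (W.baseChange K) n (∑ i, a i • xs i) ρ = 0) → ∑ i, a i • xs i = 0)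
    (Nv : ι → ℕ) (hNe : ∀ i, Nv i ≤ e i) (heM : ∀ i, e i ≤ M) (hNπ : ∀ i, Nv (π i) = Nv i) :
    ∃ ρ ∈ torsionFixing (W.baseChange K) n, ∀ m ∈ evalKer (W.baseChange K) n xs, ∀ i,
      ((2 : ℤ) ^ Nv i) • h1Eval (W.baseChange K) n (xs i) (hτ.conjGalCMH (ρ * m) * (ρ * m)) = 0 ∧
      (Nv i ≠ 0 →
        ((2 : ℤ) ^ (Nv i - 1)) • h1Eval (W.baseChange K) n (xs i) (hτ.conjGalCMH (ρ * m) * (ρ * m))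
          ≠ 0) := by
  -- the targets
  obtain ⟨x, hxe, hx⟩ := exists_orders_of_tauStable (hτ.torsionMap W n) hPM hfree π hπ e Nv hNe
    heM hNπ
  -- realise them as evaluations
  obtain ⟨ρ, hρ, hρe⟩ := exists_h1Eval_eq_of_indep_of_res (W.baseChange K) Nat.prime_two h2n hS hC
    xs e he hind hres x hxe
  refine ⟨ρ, hρ, fun m hm i ↦ ?_⟩
  have hρm : ρ * m ∈ torsionFixing (W.baseChange K) n := mul_mem hρ hm.1
  have hval : h1Eval (W.baseChange K) n (xs i) (hτ.conjGalCMH (ρ * m) * (ρ * m)) =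
      hτ.torsionMap W n (x (π i)) + x i := by
    rw [h1Eval_mul _ _ _ (hτ.conjGalCMH_mem_torsionFixing W hinv _ hρm),
      h1Eval_conjGalCMH_of_tauStable W hτ hinv n hxs hρm, h1Eval_mul _ _ _ hρ,
      h1Eval_mul _ _ _ hρ, hρe i, hρe (π i), hm.2 i, hm.2 (π i), add_zero, add_zero]
  rw [hval]
  exact hx i

end Summit.BirchSwinnertonDyer.BirchSwinnertonDyer.Theorems.GenusExact

end
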